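import Summits.QuantumFields.YangMills.Theorems.BalabanUVNodesN22WindowedCouplingHoloOfJointHolo
import Summits.QuantumFields.YangMills.Theorems.BalabanUVNodesN22WindowedSecondDiffOutputLevel
import Summits.QuantumFields.YangMills.Theorems.BalabanUVNodesN22KernelFadingOfStepRateTwoConstants
import Summits.QuantumFields.YangMills.Theorems.BalabanUVNodesN18KingModelOneRun
import Summits.QuantumFields.YangMills.Theorems.BalabanUVNodesN18KernelStepRateKingMechanism

/-!
# BalabanUVNodes ∕ node N22 = NE9 — THE WINDOWED COUPLING-HOLOMORPHY DATUM FOR node00-def-W1's LOCALIZED SUM from PER-TERM joint charts: additivity of (1.20) over the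
# (1.7) terms + the field-Hessian extraction per term (`…N22WindowedCouplingHoloOfJointHolo`) + dag-n22-w2's soft two-point summation ⟹ the `hA` binder of
# `…N22KernelFadingOfStepRateTwoConstants` at `ℰ := localizedSum F S emb` with the decay `e^{−δ₁|z|₁}`, eventually in the volume

WIDTH SEAT dag-n22-w1 (g4), piece C4 of its own lineage (C1 `…N22WindowedTwoConstants` → C2 `…N22KernelFadingOfStepRateTwoConstants` → C3 `…N22WindowedCouplingHoloOfJointHolo`):
the LOCALIZED-SUM ∕ DECAY edition of C3, i.e. the analytic road (ROAD 3) of the N22 row fed by OUTPUT-LEVEL objects, in the currency of dag-n22-c's J39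
`…N22WindowedSecondDiffOutputLevel` (domains `domSys`, probe readings `ι`, site weights `w` with (5.10)-type tails, soft two-point sums) — J39 is the second-difference
road (ROAD 2, rate `√ω`-type); this file is its holomorphic twin (two-constants road, `ℓ.ω` anywhere in `]ℓ.θ₅, 1[`).

WHAT.  §1 `exists_holo_polWindow_localizedSum` — at ONE volume index `K`: per-term JOINT charts `𝒢 X : ℂ × Ec → ℂ`, holomorphic on `Dt ×ˢ ball 0 R`, bounded by `Mx X`, agreeing on
real couplings `t ∈ ]0, γ]` and real fields with the term's functional read through `emb` after the chart `exp ∘ ρ`, REAL there, with site weights `w X s` for the probe directions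
⟹ a function `Fc` holomorphic on `Dt`, bounded by `∑_X 16·Mx X∕R² · w X (site z) · w X (site 0)`, and EQUAL on `]0, γ]` to the windowed polarization kernel `polWindow` of the
localized sum at the updated history (C3's `exists_holo_polScalar` per term + `polScalar_finset_sum`).  §2 `windowedCouplingHolo_localizedSum` — with J39 §3's tails
`w ≤ B₃ e^{−δ₀ distCT}` and chart bounds `B e^{−κE dj X}`: dag-n22-c's `outputValueSummand_le_softMajorant` + dag-n22-w2's `eventually_le_of_softSum_domSys` turn §1's bound into
`C₂ · e^{−δ₁ |z|₁}` EVENTUALLY in `K` (`δ₁ = delta1 δ₀ κ (4M)`, `C₂ = (16 B B₃²∕R²)·e^{3δ₁·4M}·K₀(64,8)·K₁(4,δ₀∕2)`) — exactly the `hA` binder of C2 for `ℰ := localizedSum F S emb`.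
§3 ★★★ `ne9_EA_objectsOfRecord₁₃_of_kernelStepRate_jointCharts` — AT THE RECORD: W1-20's law `Localizes17OfRecord₁₃` (volume threshold `k + 1`, UNIFORM in the history) carries §2's
datum to the merged term family of record; N18's `KernelStepRateOfRecord₁₃` and the decay are lowered to the rate `δ₁` (`kernelStepRate_mono` ∕ `decayBound_mono`, by name); C2 §2
gives `NE9 ((objectsOfRecord₁₃ F N θ ℓ).EA 0) (Window θ.γ) ℓ.κ ℓ.moduli` under the displayed rows; ★★★ pin face `n22At_rateCarriers_of_kernels_pin_of_kernelStepRate_jointCharts`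
(`N22At (rateCarriersOfRecord₁₃CoPH 𝔯 F θ hP g₀ os k).u3`, via dag-n22-w5's `n22At_rateCarriers_of_kernels_pin_of_ne9`).

HONEST FRAMING.  Hypothesis form throughout: N18's letter, the uniform decay, (1.21) existence, W1-20's law and the per-term joint charts with their (1.18)-type bounds are
BINDERS, not discharged here; nothing of [I] = Bałaban CMP 109 (1987) ∕ [II] = CMP 116 (1988) is asserted (cited as TYPES: (1.7), (1.18)–(1.22) of [I] pp.259–264; the
polarization decay (5.10) of [I] p. 293 — v1.1 DOCFIX (referee ref-O READ-319): v1.0 mis-attributed (5.10) to [II]; (2.13)–(2.14) pp. 14–15 of [II]); N22 NOT discharged; K3⁸ `SpineGivenEndpointR13SepCoPHV` OPEN, not claimed; counts unmoved; R4 closes the CONDITIONAL finite-𝕋⁴ rung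
`BalabanLadder.UV` only; the Yang–Mills mass gap (Clay) is NOT proved by any of this.  No `sorry`, no new axiom, no `def`, standard axioms only.
-/

noncomputable section

open Filter Topology Set Metric
open scoped BigOperators

namespace YMDAG.N22.JointHoloLocalTerms

open Literature.MathematicalPhysics.QuantumFieldTheory.Balaban1983to89
open Literature.MathematicalPhysics.QuantumFieldTheory.Balaban1983to89.T4Continuum (T4Family)
open Literature.MathematicalPhysics.QuantumFieldTheory.Balaban1983to89.T4OutputRate (Window)
open Literature.MathematicalPhysics.QuantumFieldTheory.Balaban1983to89.TreeLengthTorus (TPt torusTreeLen torusTreeLen_nonneg)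
open Literature.MathematicalPhysics.QuantumFieldTheory.Balaban1983to89.B12TreeDecay (K₀ kappa₀ K₀_pos)
open Literature.MathematicalPhysics.QuantumFieldTheory.Balaban1983to89.B12PolarizationTensor120 (polTensor polComp expChart expChart_apply)
open Literature.MathematicalPhysics.QuantumFieldTheory.Balaban1983to89.B12Decay510 (delta1)
open Literature.MathematicalPhysics.QuantumFieldTheory.Balaban1983to89.B12Decay510Window (K₁ K₁_nonneg)
open Literature.MathematicalPhysics.QuantumFieldTheory.Balaban1983to89.B12Decay510Torus (distCT nearT)
open Literature.MathematicalPhysics.QuantumFieldTheory.Balaban1983to89.B12Sec2to5 (l1)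
open Literature.MathematicalPhysics.QuantumFieldTheory.Balaban1983to89.Node00 (TermFamily1 polScalar polWindow siteOfInt mergedTermFamilyMatT TβOfRecord₁₃ chiβOfRecord₁₃
  Stage13Params Stage13HParams MatA U3Letters₁₁)
open Literature.MathematicalPhysics.QuantumFieldTheory.Balaban1983to89.Node00.Sect2 (domSys domCount CPair)
open Literature.MathematicalPhysics.QuantumFieldTheory.Balaban1983to89.Node00.W1
open Literature.MathematicalPhysics.QuantumFieldTheory.Balaban1983to89.Node00.LocalizedSum17 (localizedSum ReadingMaps localizedSum_apply Localizes17OfRecord₁₃)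
open Literature.MathematicalPhysics.QuantumFieldTheory.Balaban1983to89.Node00.U3OfKernels (objectsOfRecord₁₃)
open Literature.MathematicalPhysics.QuantumFieldTheory.Balaban1983to89.Node00.U3KernelLetters (KernelStepRateOfRecord₁₃ PolLimitsExistOfRecord₁₃)
open Literature.MathematicalPhysics.QuantumFieldTheory.Balaban1983to89.T4OutputRate (NE9 DecayBound)
open Literature.MathematicalPhysics.QuantumFieldTheory.Balaban1983to89.T4Continuum (ULoop)
open Summit.QuantumFields.YangMills.BalabanUVNodes.N18KingModelOneRun (decayBound_mono)
open YMDAG.N18.KernelStepRateKingMechanism (kernelStepRate_mono)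
open YMDAG.UVSplit (N22At RateReading₁₃CoPH rateCarriersOfRecord₁₃CoPH)
open YMDAG.N22.KernelFadingTwoConstants (ne9_EA_objectsOfRecord₁₃_of_kernelStepRate_windowedHolo n22At_rateCarriers_of_kernels_pin_of_kernelStepRate_windowedHolo)
open Literature.MathematicalPhysics.QuantumFieldTheory.Balaban1983to89.Node00.U3OfKernels (histPrefix histPrefix_apply)
open YMDAG.N22.WindowOfLocalTerms (polScalar_finset_sum contDiffAt_two_of_holomorphic)
open YMDAG.N22.WindowSoftTwoPoint (eventually_le_of_softSum_domSys)
open YMDAG.N22.OutputLevel (outputValueSummand_le_softMajorant)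
open YMDAG.N22.JointHolo (exists_holo_polScalar differentiableOn_slice)
open YMDAG.N22.AtKernels (n22At_rateCarriers_of_kernels_pin_of_ne9)
open scoped Matrix.Norms.L2Operator

/-! ## §1 AT ONE WINDOW: the windowed kernel of the localized sum along a one-coupling update extends holomorphically, term by term -/

section Window

variable {𝔄 : Type*} [NormedRing 𝔄] [NormedAlgebra ℝ 𝔄] {V : Type*} [NormedAddCommGroup V] [NormedSpace ℝ V] {ι' : Type*} [Fintype ι']
variable {𝔸 : Type*} {M : ℕ} (F : T4Family) (S : (K : ℕ) → ClusterTower (F.P K) 𝔸 M) (emb : ReadingMaps F 𝔄 𝔸) (ρ : V →L[ℝ] 𝔄)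
  (bV : Module.Basis ι' ℝ V) (k K : ℕ) {Ec : Type*} [NormedAddCommGroup Ec] [NormedSpace ℂ Ec]

/-- ★★ **PER-TERM JOINT CHARTS ⟹ A HOLOMORPHIC EXTENSION OF THE LOCALIZED SUM's WINDOWED KERNEL ALONG A ONE-COUPLING UPDATE, WITH THE SOFT TWO-POINT BOUND.**
At ONE volume index `K` and level `k`, base history `h`, young coupling `m`: IF for every domain `X` ONE function `𝒢 X : ℂ × Ec → ℂ` is complex-differentiable on the open
`Dt × ball(0, R)` with `‖𝒢 X‖ ≤ Mx X` there, and AGREES at real couplings with the (2.13) term read through the exponential chart and a real-linear complexification `ι X`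
of the probe fields — `𝒢 X (t, ι X B) = E^{(k+1)}(X; (h|h_m:=t)_{≤k}; emb (exp ρB))`, the term being REAL there (`hIm`) — and the one-site colour directions have norms
`‖ι X e_{l,s,c}‖ ≤ w X s`: THEN `t ↦ Π^{(K)}_{k+1}[localizedSum](h|h_m:=t; z)` is the restriction of a function `Fc` holomorphic on `Dt` with
`‖Fc τ‖ ≤ Σ_X 16·Mx(X)·R⁻²·w_X(x_z)·w_X(x_0)` — additivity of (1.20) (J27 `polScalar_finset_sum`) + `JointHolo.exists_holo_polScalar` per term. [folklore] -/
theorem exists_holo_polWindow_localizedSum (h : ℕ → ℝ) (m : ℕ) {γ : ℝ} (hγ : 0 < γ)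
    (ι : (domSys (F.P K) M (k + 1)).Dom → ((Fin (F.P K).d → Site (F.P K) (k + 1) → V) →L[ℝ] Ec))
    (𝒢 : (domSys (F.P K) M (k + 1)).Dom → ℂ × Ec → ℂ) {Dt : Set ℂ} (hDt : IsOpen Dt) {R : ℝ} (hR : 0 < R)
    (h𝒢 : ∀ X, DifferentiableOn ℂ (𝒢 X) (Dt ×ˢ ball (0 : Ec) R)) (Mx : (domSys (F.P K) M (k + 1)).Dom → ℝ)
    (hM : ∀ X, ∀ p ∈ Dt ×ˢ ball (0 : Ec) R, ‖𝒢 X p‖ ≤ Mx X) (hreal : ∀ t ∈ Ioc (0 : ℝ) γ, (t : ℂ) ∈ Dt)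
    (hf : ∀ X, ∀ t ∈ Ioc (0 : ℝ) γ, ∀ B : Fin (F.P K).d → Site (F.P K) (k + 1) → V,
      𝒢 X (t, ι X B) = ((S K) k).E (histPrefix (Function.update h m t) k) (emb K k (fun l s => NormedSpace.exp (ρ (B l s)))) X)
    (hIm : ∀ X, ∀ t ∈ Ioc (0 : ℝ) γ, ∀ B : Fin (F.P K).d → Site (F.P K) (k + 1) → V,
      (((S K) k).E (histPrefix (Function.update h m t) k) (emb K k (fun l s => NormedSpace.exp (ρ (B l s)))) X).im = 0)
    (w : (domSys (F.P K) M (k + 1)).Dom → Site (F.P K) (k + 1) → ℝ) (hw₀ : ∀ X s, 0 ≤ w X s)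
    (hw : ∀ X (l : Fin (F.P K).d) (s : Site (F.P K) (k + 1)) (c : ι'), ‖ι X (Pi.single l (Pi.single s (bV c)))‖ ≤ w X s)
    (μ ν : Fin 4) (z : Fin 4 → ℤ) :
    ∃ Fc : ℂ → ℂ, DifferentiableOn ℂ Fc Dt ∧
      (∀ τ ∈ Dt, ‖Fc τ‖ ≤ ∑ X : (domSys (F.P K) M (k + 1)).Dom, 16 * Mx X / R ^ 2 * (w X (siteOfInt F K (k + 1) z) * w X (siteOfInt F K (k + 1) 0))) ∧
      (∀ t ∈ Ioc (0 : ℝ) γ, Fc t = (polWindow F K (k + 1) (localizedSum F S emb k (histPrefix (Function.update h m t) k) K) ρ bV μ ν z : ℂ)) := by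
  classical
  -- the per-term real charts and their agreement with the joint charts
  set ℰt : (domSys (F.P K) M (k + 1)).Dom → ℝ → ((Fin (F.P K).d → Site (F.P K) (k + 1) → 𝔄) → ℝ) :=
    fun X t W => (((S K) k).E (histPrefix (Function.update h m t) k) (emb K k W) X).re with hℰt
  have hfre : ∀ X, ∀ t ∈ Ioc (0 : ℝ) γ, ∀ B, 𝒢 X (t, ι X B) = ((expChart (ℰt X t) ρ B : ℝ) : ℂ) := by
    intro X t ht B
    rw [hf X t ht B, expChart_apply]
    apply Complex.ext
    · simp [hℰt]
    · rw [Complex.ofReal_im]; exact hIm X t ht B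
  -- per term: the holomorphic extension of its scalar kernel
  set x' : Site (F.P K) (k + 1) := siteOfInt F K (k + 1) z with hx'
  set y' : Site (F.P K) (k + 1) := siteOfInt F K (k + 1) 0 with hy'
  set μ' : Fin (F.P K).d := Fin.cast (F.P_d K).symm μ with hμ'
  set ν' : Fin (F.P K).d := Fin.cast (F.P_d K).symm ν with hν'
  have hX := fun X => exists_holo_polScalar ρ bV (ℰt X) hDt hR (𝒢 X) (h𝒢 X) (hM X) (ι X) hreal (hfre X) μ' x' ν' y'
  choose Fx hFx hbd hagree using hX
  refine ⟨fun τ => ∑ X, Fx X τ, ?_, ?_, ?_⟩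
  · have hfun : (fun τ => ∑ X, Fx X τ) = ∑ X, Fx X := by funext τ; simp only [Finset.sum_apply]
    rw [hfun]
    exact DifferentiableOn.sum fun X _ => hFx X
  · intro τ hτ
    refine (norm_sum_le _ _).trans (Finset.sum_le_sum fun X _ => (hbd X τ hτ).trans ?_)
    have hM0 : 0 ≤ Mx X := (norm_nonneg _).trans (hM X ((γ : ℂ), (0 : Ec)) ⟨hreal γ ⟨hγ, le_rfl⟩, mem_ball_self hR⟩)
    have hS : (Fintype.card ι' : ℝ)⁻¹ * ∑ c, ‖ι X (Pi.single μ' (Pi.single x' (bV c)))‖ * ‖ι X (Pi.single ν' (Pi.single y' (bV c)))‖ ≤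
        w X x' * w X y' := by
      have h1 : ∑ c, ‖ι X (Pi.single μ' (Pi.single x' (bV c)))‖ * ‖ι X (Pi.single ν' (Pi.single y' (bV c)))‖ ≤ ∑ _c : ι', w X x' * w X y' :=
        Finset.sum_le_sum fun c _ => mul_le_mul (hw X μ' x' c) (hw X ν' y' c) (norm_nonneg _) (hw₀ X x')
      rw [Finset.sum_const, Finset.card_univ, nsmul_eq_mul] at h1
      by_cases hc : (Fintype.card ι' : ℝ) = 0
      · rw [hc, inv_zero, zero_mul]; exact mul_nonneg (hw₀ X x') (hw₀ X y')
      · calc (Fintype.card ι' : ℝ)⁻¹ * ∑ c, ‖ι X (Pi.single μ' (Pi.single x' (bV c)))‖ * ‖ι X (Pi.single ν' (Pi.single y' (bV c)))‖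
            ≤ (Fintype.card ι' : ℝ)⁻¹ * ((Fintype.card ι' : ℝ) * (w X x' * w X y')) := mul_le_mul_of_nonneg_left h1 (inv_nonneg.2 (Nat.cast_nonneg _))
          _ = w X x' * w X y' := by rw [inv_mul_cancel_left₀ hc]
    exact mul_le_mul_of_nonneg_left hS (by positivity)
  · -- agreement: additivity of (1.20) over the local terms
    intro t ht
    have hC2 : ∀ X ∈ (Finset.univ : Finset (domSys (F.P K) M (k + 1)).Dom), ContDiffAt ℝ 2 (expChart (ℰt X t) ρ) 0 := by
      intro X _
      have hfun : expChart (ℰt X t) ρ = fun B => (𝒢 X ((t : ℂ), ι X B)).re := by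
        funext B; rw [hfre X t ht B, Complex.ofReal_re]
      rw [hfun]
      exact contDiffAt_two_of_holomorphic (fun B => 𝒢 X ((t : ℂ), B)) (differentiableOn_slice (h𝒢 X) (hreal t ht)) isOpen_ball (ι X)
        (by rw [map_zero]; exact mem_ball_self hR)
    have hsum : localizedSum F S emb k (histPrefix (Function.update h m t) k) K = fun W => ∑ X ∈ (Finset.univ : Finset _), ℰt X t W := by
      funext W; rw [localizedSum_apply]
    show ∑ X, Fx X t = ((polScalar (localizedSum F S emb k (histPrefix (Function.update h m t) k) K) ρ bV μ' x' ν' y' : ℝ) : ℂ)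
    rw [hsum, polScalar_finset_sum _ _ ρ bV hC2 μ' x' ν' y']
    push_cast
    exact Finset.sum_congr rfl fun X _ => hagree X t ht

end Window

/-! ## §2 EVENTUALLY IN THE VOLUME, WITH THE DECAY: the `hA` binder of `…KernelFadingOfStepRateTwoConstants` at `ℰ := localizedSum F S emb` -/

section Letter

variable (F : T4Family) {𝔄 : Type*} [NormedRing 𝔄] [NormedAlgebra ℝ 𝔄] {V : Type*} [NormedAddCommGroup V] [NormedSpace ℝ V]
  {ι' : Type*} [Fintype ι'] {𝔸 : Type*} {M : ℕ}

open Classical in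
/-- ★★★ **THE WINDOWED COUPLING-HOLOMORPHY DATUM OF THE ANALYTIC KERNEL-FADING ROAD AT node00-def-W1's LOCALIZED SUM, FROM PER-TERM JOINT CHARTS.**  Cube side `M = L^{m′}`;
for every volume index `K`, level `k`, window base history `h`, young coupling `m` and domain `X ∈ 𝐃_{k+1}`: ONE function `𝒢 K k h m X : ℂ × Ec K k → ℂ`, complex-differentiable on
the open `Dt × ball(0, R)` (`Dt ⊇` the closed `r₀`-discs about `]0, γ]`), bounded there by `B·e^{−κ_E d_{k+1}(X)}` (JOINT coupling∕field analyticity of the (2.13) term with the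
printed (1.18)-type bound — [I] p. 266 + (1.19)–(1.20), read at finite volume; DISPLAYED), agreeing at real couplings with the term read through the exponential chart and the
complexified probe reading `ι K k X` (`𝒢 (t, ι B) = E^{(k+1)}(X; (h|h_m:=t)_{≤k}; emb(exp ρB))`, the term REAL there); site weights `‖ι K k X e_{l,s,c}‖ ≤ w K k X s` with the tails
`w ≤ B₃e^{−δ₀ distCT(s, X)}` ([I] p. 282); `δ₀ > 0`, `2κ₀(64,8) ≤ κ ≤ κ_E`.  THEN for every window history `h`, level `k`, entry `(μν, z)` and young coupling `m`, EVENTUALLY IN `K`: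
`∃ Fc D, Fc holomorphic on D ∧ ‖Fc‖ ≤ C·e^{−δ₁|z|₁} on D ∧ the closed r₀-discs about ]0,γ] ⊆ D ∧ Fc t = Π^{(K)}_{k+1}[localizedSum](h|h_m:=t; z)`,
`C = (16B·B₃²∕R²)·e^{3·4M·δ₁}K₀(64,8)K₁(4,δ₀∕2)`, `δ₁ = ½min{δ₀, κ(4M)⁻¹}` — LITERALLY the binder `hA` of `KernelFadingTwoConstants.ne9_and_fadingMemory_EA_of_kernelStepRate_windowedHolo`
at `(ℰ, κ, B, r) := (localizedSum F S emb, δ₁, C, r₀)` (§1 at each `K` + J36 `outputValueSummand_le_softMajorant` + dag-n22-w2 `eventually_le_of_softSum_domSys`). [folklore] -/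
theorem windowedCouplingHolo_localizedSum (m' : ℕ) (M : ℕ) [NeZero M] (hM : M = F.L ^ m')
    (S : (K : ℕ) → ClusterTower (F.P K) 𝔸 M) (emb : ReadingMaps F 𝔄 𝔸) (ρ : V →L[ℝ] 𝔄) (bV : Module.Basis ι' ℝ V)
    {γ κ κE δ₀ B₃ B R r₀ : ℝ} (hγ : 0 < γ) (hR : 0 < R) (hκ₀ : kappa₀ (4 * 2 ^ 4) (2 * 4) ≤ κ / 2) (hδ₀ : 0 < δ₀) (hB₃ : 0 ≤ B₃) (hB : 0 ≤ B)
    (hκE : κ ≤ κE)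
    (Ec : ℕ → ℕ → Type*) [∀ K k, NormedAddCommGroup (Ec K k)] [∀ K k, NormedSpace ℂ (Ec K k)]
    (ι : (K k : ℕ) → (domSys (F.P K) M (k + 1)).Dom → ((Fin (F.P K).d → Site (F.P K) (k + 1) → V) →L[ℝ] Ec K k))
    {Dt : Set ℂ} (hDt : IsOpen Dt) (hdisc : ∀ t ∈ Ioc (0 : ℝ) γ, closedBall (t : ℂ) r₀ ⊆ Dt) (hr₀ : 0 ≤ r₀)
    (𝒢 : (K k : ℕ) → (ℕ → ℝ) → ℕ → (domSys (F.P K) M (k + 1)).Dom → ℂ × Ec K k → ℂ)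
    (h𝒢 : ∀ (K k : ℕ), ∀ h ∈ Window γ, ∀ (m : ℕ) (X : (domSys (F.P K) M (k + 1)).Dom), DifferentiableOn ℂ (𝒢 K k h m X) (Dt ×ˢ ball (0 : Ec K k) R))
    (hM𝒢 : ∀ (K k : ℕ), ∀ h ∈ Window γ, ∀ (m : ℕ) (X : (domSys (F.P K) M (k + 1)).Dom), ∀ p ∈ Dt ×ˢ ball (0 : Ec K k) R,
      ‖𝒢 K k h m X p‖ ≤ B * Real.exp (-(κE * (domSys (F.P K) M (k + 1)).dj X)))
    (hf : ∀ (K k : ℕ), ∀ h ∈ Window γ, ∀ (m : ℕ) (X : (domSys (F.P K) M (k + 1)).Dom), ∀ t ∈ Ioc (0 : ℝ) γ,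
      ∀ Bf : Fin (F.P K).d → Site (F.P K) (k + 1) → V,
        𝒢 K k h m X (t, ι K k X Bf) = ((S K) k).E (histPrefix (Function.update h m t) k) (emb K k (fun l s => NormedSpace.exp (ρ (Bf l s)))) X)
    (hIm : ∀ (K k : ℕ), ∀ h ∈ Window γ, ∀ (m : ℕ) (X : (domSys (F.P K) M (k + 1)).Dom), ∀ t ∈ Ioc (0 : ℝ) γ,
      ∀ Bf : Fin (F.P K).d → Site (F.P K) (k + 1) → V,
        (((S K) k).E (histPrefix (Function.update h m t) k) (emb K k (fun l s => NormedSpace.exp (ρ (Bf l s)))) X).im = 0)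
    (w : (K k : ℕ) → (domSys (F.P K) M (k + 1)).Dom → Site (F.P K) (k + 1) → ℝ) (hw₀ : ∀ K k X t, 0 ≤ w K k X t)
    (hw : ∀ (K k : ℕ) (X : (domSys (F.P K) M (k + 1)).Dom) (l : Fin (F.P K).d) (t : Site (F.P K) (k + 1)) (c : ι'),
      ‖ι K k X (Pi.single l (Pi.single t (bV c)))‖ ≤ w K k X t)
    (htail : ∀ (K k : ℕ) (X : (domSys (F.P K) M (k + 1)).Dom) (t : Site (F.P K) (k + 1)),
      let e : Site (F.P K) (k + 1) → TPt 4 (domCount (F.P K) M (k + 1) * M) := fun x i => (ZMod.cast (x i) : ZMod (domCount (F.P K) M (k + 1) * M))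
      w K k X t ≤ B₃ * Real.exp (-δ₀ * distCT (domCount (F.P K) M (k + 1)) M (e t) (nearT (M := M) (e t) X))) :
    ∀ h ∈ Window γ, ∀ (k : ℕ) (μ ν : Fin 4) (z : Fin 4 → ℤ) (m : ℕ), m < k + 1 → ∀ᶠ K in atTop,
      ∃ (Fc : ℂ → ℂ) (D : Set ℂ), DifferentiableOn ℂ Fc D ∧
        (∀ w' ∈ D, ‖Fc w'‖ ≤ (16 * B * B₃ ^ 2 / R ^ 2) * Real.exp (delta1 δ₀ κ ((M : ℝ) * 4) * ((M : ℝ) * 4) * 3) * K₀ (4 * 2 ^ 4) (2 * 4) *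
            K₁ 4 (δ₀ / 2) * Real.exp (-(delta1 δ₀ κ ((M : ℝ) * 4) * l1 z))) ∧
        (∀ t ∈ Ioc (0 : ℝ) γ, closedBall (t : ℂ) r₀ ⊆ D) ∧
        (∀ t ∈ Ioc (0 : ℝ) γ, Fc t = (polWindow F K (k + 1) (localizedSum F S emb k (histPrefix (Function.update h m t) k) K) ρ bV μ ν z : ℂ)) := by
  intro h hh k μ ν z m _
  have hreal : ∀ t ∈ Ioc (0 : ℝ) γ, (t : ℂ) ∈ Dt := fun t ht => hdisc t ht (mem_closedBall_self hr₀)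
  -- §1 at every volume index
  have hK := fun K => exists_holo_polWindow_localizedSum F S emb ρ bV k K h m hγ (ι K k) (𝒢 K k h m) hDt hR (h𝒢 K k h hh m)
    (fun X => B * Real.exp (-(κE * torusTreeLen X.1))) (fun X p hp => hM𝒢 K k h hh m X p hp) hreal (hf K k h hh m) (hIm K k h hh m)
    (w K k) (hw₀ K k) (hw K k) μ ν z
  choose Fc hFc hbd hagree using hK
  -- the soft two-point sums are eventually `≤ C e^{−δ₁|z|₁}`
  have hCE : (0 : ℝ) ≤ 16 * B * B₃ ^ 2 / R ^ 2 := by positivity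
  have hev := eventually_le_of_softSum_domSys F (k + 1) m' M hM
    (fun K => ∑ X : (domSys (F.P K) M (k + 1)).Dom, 16 * (B * Real.exp (-(κE * torusTreeLen X.1))) / R ^ 2 *
      (w K k X (siteOfInt F K (k + 1) z) * w K k X (siteOfInt F K (k + 1) 0)))
    (fun K X => 16 * (B * Real.exp (-(κE * torusTreeLen X.1))) / R ^ 2 * (w K k X (siteOfInt F K (k + 1) z) * w K k X (siteOfInt F K (k + 1) 0)))
    hCE zero_le_one hδ₀ hκ₀ z (fun K => le_rfl)
    (fun K X => outputValueSummand_le_softMajorant hB hR hB₃ (hw₀ K k X _) (Real.exp_nonneg _) (Real.exp_nonneg _) (htail K k X _) (htail K k X _) hκE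
      (torusTreeLen_nonneg _))
  filter_upwards [hev] with K hKev
  refine ⟨Fc K, Dt, hFc K, fun w' hw' => ((hbd K) w' hw').trans (hKev.trans (le_of_eq (by ring))), hdisc, hagree K⟩

end Letter

/-! ## §3 AT THE RECORD: W1-20's law carries the datum to the merged term family (its volume threshold `k + 1` does NOT read the history), and C2 §2 gives `h9` -/

section Record

variable (F : T4Family) (N : ℕ) [NeZero N] {𝔸 : Type*} {M : ℕ}

open Classical in
/-- ★★★ **K3 §2b's `h9` WITH THE RECORD's GEOMETRIC MODULI ON THE ANALYTIC ROAD, FROM PER-TERM JOINT CHARTS.**  At a Stage-13 tuple `θ` (`0 < θ.γ`) and a letter block `ℓ` with its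
signs: node N18's `KernelStepRateOfRecord₁₃ F N θ κ₅ ℓ.θ₅ C₅`, the uniform kernel decay `DecayBound ((objectsOfRecord₁₃ F N θ ℓ).EA 0) (Window θ.γ) E₀ κd` (`E₀ > 0`), (1.21)
existence `PolLimitsExistOfRecord₁₃ F N θ`, W1-20's law `Localizes17OfRecord₁₃ F N θ S emb` for towers `S` read through `emb`, and §2's PER-TERM JOINT CHART datum for the
localized sum (charts `𝒢`, complexified probe readings `ι` with site weights `w` and tails, at the record's β-chart `θ.ρ8`, colour basis `θ.bV`); rows `δ₁ ≤ κ₅`, `δ₁ ≤ κd`,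
`0 < s < 1`, `ℓ.θ₅^{1−s} ≤ ℓ.ω`, `ℓ.κ ≤ δ₁`, `C₉(s) ≤ ℓ.C₉` (`δ₁ = ½min{δ₀, κ(4M)⁻¹}`) ⟹ **`NE9 ((objectsOfRecord₁₃ F N θ ℓ).EA 0) (Window θ.γ) ℓ.κ ℓ.moduli`**.
MECHANISM: §2 gives C2's `hA` for `localizedSum F S emb` eventually in `K`; the law's threshold `K ≥ k + 1` is UNIFORM in the history, so the same `Fc` serves the merged
term family of record; node N18's letter and the decay are taken down to the rate `δ₁` (dag-n18 lanes' `kernelStepRate_mono` ∕ `decayBound_mono`); then C2 §2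
`ne9_EA_objectsOfRecord₁₃_of_kernelStepRate_windowedHolo`.  THE N22 ROW SENTENCE, analytic road: «N18's kernel step rate + uniform decay + (1.21) + W1-20's law + per-term JOINT
coupling∕field charts with the (1.18)-type bound + tails + rows (`ℓ.ω` ANYWHERE in `]ℓ.θ₅, 1[`) ⇒ `h9` with the record's geometric moduli».  LOCATED; N22 NOT discharged. [folklore] -/
theorem ne9_EA_objectsOfRecord₁₃_of_kernelStepRate_jointCharts (θ : Stage13Params F N) (ℓ : U3Letters₁₁) (hs : ℓ.Signs) (hγ : 0 < θ.γ)
    (hlim : PolLimitsExistOfRecord₁₃ F N θ) {κ₅ κd C₅ E₀ : ℝ} (hC₅ : 0 ≤ C₅) (hE₀ : 0 < E₀)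
    (h5 : KernelStepRateOfRecord₁₃ F N θ κ₅ ℓ.θ₅ C₅) (hdec : DecayBound ((objectsOfRecord₁₃ F N θ ℓ).EA 0) (Window θ.γ) E₀ κd)
    (m' : ℕ) (M : ℕ) [NeZero M] (hM : M = F.L ^ m')
    (S : (K : ℕ) → ClusterTower (F.P K) 𝔸 M) (emb : ReadingMaps F (MatA N) 𝔸) (hloc : Localizes17OfRecord₁₃ F N θ S emb)
    {κ κE δ₀ B₃ B R r₀ s : ℝ} (hR : 0 < R) (hκ₀ : kappa₀ (4 * 2 ^ 4) (2 * 4) ≤ κ / 2) (hδ₀ : 0 < δ₀) (hB₃ : 0 ≤ B₃) (hB : 0 ≤ B) (hκE : κ ≤ κE)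
    (hr₀ : 0 < r₀) (hs0 : 0 < s) (hs1 : s < 1)
    (Ec : ℕ → ℕ → Type*) [∀ K k, NormedAddCommGroup (Ec K k)] [∀ K k, NormedSpace ℂ (Ec K k)]
    (ι : letI := θ.instVβ₁; letI := θ.instVβ₂
      (K k : ℕ) → (domSys (F.P K) M (k + 1)).Dom → ((Fin (F.P K).d → Site (F.P K) (k + 1) → θ.Vβ) →L[ℝ] Ec K k))
    {Dt : Set ℂ} (hDt : IsOpen Dt) (hdisc : ∀ t ∈ Ioc (0 : ℝ) θ.γ, closedBall (t : ℂ) r₀ ⊆ Dt)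
    (𝒢 : (K k : ℕ) → (ℕ → ℝ) → ℕ → (domSys (F.P K) M (k + 1)).Dom → ℂ × Ec K k → ℂ)
    (h𝒢 : ∀ (K k : ℕ), ∀ h ∈ Window θ.γ, ∀ (m : ℕ) (X : (domSys (F.P K) M (k + 1)).Dom), DifferentiableOn ℂ (𝒢 K k h m X) (Dt ×ˢ ball (0 : Ec K k) R))
    (hM𝒢 : ∀ (K k : ℕ), ∀ h ∈ Window θ.γ, ∀ (m : ℕ) (X : (domSys (F.P K) M (k + 1)).Dom), ∀ p ∈ Dt ×ˢ ball (0 : Ec K k) R,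
      ‖𝒢 K k h m X p‖ ≤ B * Real.exp (-(κE * (domSys (F.P K) M (k + 1)).dj X)))
    (hf : letI := θ.instVβ₁; letI := θ.instVβ₂
      ∀ (K k : ℕ), ∀ h ∈ Window θ.γ, ∀ (m : ℕ) (X : (domSys (F.P K) M (k + 1)).Dom), ∀ t ∈ Ioc (0 : ℝ) θ.γ,
        ∀ Bf : Fin (F.P K).d → Site (F.P K) (k + 1) → θ.Vβ,
          𝒢 K k h m X (t, ι K k X Bf) = ((S K) k).E (histPrefix (Function.update h m t) k) (emb K k (fun l u => NormedSpace.exp (θ.ρ8 (Bf l u)))) X)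
    (hIm : letI := θ.instVβ₁; letI := θ.instVβ₂
      ∀ (K k : ℕ), ∀ h ∈ Window θ.γ, ∀ (m : ℕ) (X : (domSys (F.P K) M (k + 1)).Dom), ∀ t ∈ Ioc (0 : ℝ) θ.γ,
        ∀ Bf : Fin (F.P K).d → Site (F.P K) (k + 1) → θ.Vβ,
          (((S K) k).E (histPrefix (Function.update h m t) k) (emb K k (fun l u => NormedSpace.exp (θ.ρ8 (Bf l u)))) X).im = 0)
    (w : (K k : ℕ) → (domSys (F.P K) M (k + 1)).Dom → Site (F.P K) (k + 1) → ℝ) (hw₀ : ∀ K k X t, 0 ≤ w K k X t)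
    (hw : letI := θ.instVβ₁; letI := θ.instVβ₂; letI := θ.instιβ
      ∀ (K k : ℕ) (X : (domSys (F.P K) M (k + 1)).Dom) (l : Fin (F.P K).d) (t : Site (F.P K) (k + 1)) (c : θ.ιβ),
        ‖ι K k X (Pi.single l (Pi.single t (θ.bV c)))‖ ≤ w K k X t)
    (htail : ∀ (K k : ℕ) (X : (domSys (F.P K) M (k + 1)).Dom) (t : Site (F.P K) (k + 1)),
      let e : Site (F.P K) (k + 1) → TPt 4 (domCount (F.P K) M (k + 1) * M) := fun x i => (ZMod.cast (x i) : ZMod (domCount (F.P K) M (k + 1) * M))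
      w K k X t ≤ B₃ * Real.exp (-δ₀ * distCT (domCount (F.P K) M (k + 1)) M (e t) (nearT (M := M) (e t) X)))
    (hκ₅ : delta1 δ₀ κ ((M : ℝ) * 4) ≤ κ₅) (hκd : delta1 δ₀ κ ((M : ℝ) * 4) ≤ κd)
    (hτω : ℓ.θ₅ ^ (1 - s) ≤ ℓ.ω) (hℓκ : ℓ.κ ≤ delta1 δ₀ κ ((M : ℝ) * 4))
    (hC₉ : 32 / (s ^ 2 * min (r₀ / 2) (θ.γ / 2)) * ((2 * (2 * C₅ / (1 - ℓ.θ₅) + 2 * E₀)) ^ (1 - s) *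
        (2 * ((16 * B * B₃ ^ 2 / R ^ 2) * Real.exp (delta1 δ₀ κ ((M : ℝ) * 4) * ((M : ℝ) * 4) * 3) * K₀ (4 * 2 ^ 4) (2 * 4) * K₁ 4 (δ₀ / 2) +
          (2 * C₅ / (1 - ℓ.θ₅) + 2 * E₀))) ^ s) / ℓ.θ₅ ^ (1 - s) ≤ ℓ.C₉) :
    NE9 ((objectsOfRecord₁₃ F N θ ℓ).EA 0) (Window θ.γ) ℓ.κ ℓ.moduli := by
  letI := θ.instVβ₁; letI := θ.instVβ₂; letI := θ.instιβ
  have h1θ : 0 < 1 - ℓ.θ₅ := by linarith [hs.θ₅_lt_one]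
  have hC₀0 : 0 ≤ 2 * C₅ / (1 - ℓ.θ₅) + 2 * E₀ := by positivity
  have hC0 : 0 ≤ (16 * B * B₃ ^ 2 / R ^ 2) * Real.exp (delta1 δ₀ κ ((M : ℝ) * 4) * ((M : ℝ) * 4) * 3) * K₀ (4 * 2 ^ 4) (2 * 4) * K₁ 4 (δ₀ / 2) := by
    have := K₁_nonneg 4 (δ₀ / 2); have := K₀_pos (4 * 2 ^ 4) (2 * 4); positivity
  -- node N18's letter and the decay at the rate `δ₁`
  have h5' : KernelStepRateOfRecord₁₃ F N θ (delta1 δ₀ κ ((M : ℝ) * 4)) ℓ.θ₅ C₅ :=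
    kernelStepRate_mono F θ.ρ8 θ.bV h5 le_rfl hκ₅ hs.θ₅_pos.le le_rfl le_rfl hC₅
  have hdec' : DecayBound ((objectsOfRecord₁₃ F N θ ℓ).EA 0) (Window θ.γ) E₀ (delta1 δ₀ κ ((M : ℝ) * 4)) := decayBound_mono hdec subset_rfl hκd le_rfl
  -- §2's datum for the localized sum, carried to the merged term family of record by the law (threshold `K ≥ k + 1`, uniform in the history)
  have hAloc := windowedCouplingHolo_localizedSum F m' M hM S emb θ.ρ8 θ.bV hγ hR hκ₀ hδ₀ hB₃ hB hκE Ec ι hDt hdisc hr₀.le 𝒢 h𝒢 hM𝒢 hf hIm w hw₀ hw htail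
  have hA : ∀ h ∈ Window θ.γ, ∀ (k : ℕ) (μ ν : Fin 4) (z : Fin 4 → ℤ) (m : ℕ), m < k + 1 → ∀ᶠ K in atTop,
      ∃ (Fc : ℂ → ℂ) (D : Set ℂ), DifferentiableOn ℂ Fc D ∧
        (∀ w' ∈ D, ‖Fc w'‖ ≤ ((16 * B * B₃ ^ 2 / R ^ 2) * Real.exp (delta1 δ₀ κ ((M : ℝ) * 4) * ((M : ℝ) * 4) * 3) * K₀ (4 * 2 ^ 4) (2 * 4) *
            K₁ 4 (δ₀ / 2) + (2 * C₅ / (1 - ℓ.θ₅) + 2 * E₀)) * Real.exp (-(delta1 δ₀ κ ((M : ℝ) * 4) * l1 z))) ∧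
        (∀ t ∈ Ioc (0 : ℝ) θ.γ, closedBall (t : ℂ) r₀ ⊆ D) ∧
        (∀ t ∈ Ioc (0 : ℝ) θ.γ, Fc t = (polWindow F K (k + 1)
          (mergedTermFamilyMatT F N (TβOfRecord₁₃ F N) (chiβOfRecord₁₃ F N θ) θ.εbg k (histPrefix (Function.update h m t) k) K) θ.ρ8 θ.bV μ ν z : ℂ)) := by
    intro h hh k μ ν z m hm
    filter_upwards [hAloc h hh k μ ν z m hm, Filter.eventually_ge_atTop (k + 1)] with K hK hKk
    obtain ⟨Fc, D, hFc, hbd, hD, hagree⟩ := hK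
    refine ⟨Fc, D, hFc, fun w' hw' => (hbd w' hw').trans ?_, hD, fun t ht => ?_⟩
    · exact mul_le_mul_of_nonneg_right (le_add_of_nonneg_right hC₀0) (Real.exp_nonneg _)
    · have hlaw := hloc k (histPrefix (Function.update h m t) k) K hKk
      rw [hagree t ht, hlaw]
  have hCB : 2 * C₅ / (1 - ℓ.θ₅) + 2 * E₀ ≤ (16 * B * B₃ ^ 2 / R ^ 2) * Real.exp (delta1 δ₀ κ ((M : ℝ) * 4) * ((M : ℝ) * 4) * 3) * K₀ (4 * 2 ^ 4) (2 * 4) *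
      K₁ 4 (δ₀ / 2) + (2 * C₅ / (1 - ℓ.θ₅) + 2 * E₀) := le_add_of_nonneg_left hC0
  exact ne9_EA_objectsOfRecord₁₃_of_kernelStepRate_windowedHolo F N θ ℓ hs hγ hC₅ hE₀ hr₀ hs0 hs1 h5' hdec' hCB hlim hA hτω hℓκ hC₉

open Classical in
/-- ★★★ **PIN FACE of §3 — THE N22 ROW OF K3⁸ ON THE ANALYTIC ROAD, FROM PER-TERM JOINT CHARTS.**  At a Stage-13H tuple `θ` with provisos `hP`, a rate reading `𝔯` PINNED to the kernel
objects of record (`hpin`), and §3's inputs at `θ.toStage13Params` ⟹ **`N22At (rateCarriersOfRecord₁₃CoPH 𝔯 F θ hP g₀ os k).u3`** for every `k` — §3 composed with dag-n22-w5's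
`n22At_rateCarriers_of_kernels_pin_of_ne9` (the K3⁸ consumer reads THIS shape).  LOCATED (hypothesis form: N18's letter, the decay, (1.21), W1-20's law and the joint charts are
BINDERS); N22 NOT discharged; nothing of [I]∕[II] asserted. [folklore] -/
theorem n22At_rateCarriers_of_kernels_pin_of_kernelStepRate_jointCharts (𝔯 : RateReading₁₃CoPH N) (θ : Stage13HParams F N) (hP : θ.Provisos₁₃CoPH F N)
    (g₀ : ℕ → ℝ) (os : List (ULoop F)) (ℓ : U3Letters₁₁) (hs : ℓ.Signs) (hγ : 0 < θ.γ)
    (hpin : (𝔯.lit F θ hP g₀ os).u3 = objectsOfRecord₁₃ F N θ.toStage13Params ℓ)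
    (hlim : PolLimitsExistOfRecord₁₃ F N θ.toStage13Params) {κ₅ κd C₅ E₀ : ℝ} (hC₅ : 0 ≤ C₅) (hE₀ : 0 < E₀)
    (h5 : KernelStepRateOfRecord₁₃ F N θ.toStage13Params κ₅ ℓ.θ₅ C₅) (hdec : DecayBound ((objectsOfRecord₁₃ F N θ.toStage13Params ℓ).EA 0) (Window θ.γ) E₀ κd)
    (m' : ℕ) (M : ℕ) [NeZero M] (hM : M = F.L ^ m')
    (S : (K : ℕ) → ClusterTower (F.P K) 𝔸 M) (emb : ReadingMaps F (MatA N) 𝔸) (hloc : Localizes17OfRecord₁₃ F N θ.toStage13Params S emb)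
    {κ κE δ₀ B₃ B R r₀ s : ℝ} (hR : 0 < R) (hκ₀ : kappa₀ (4 * 2 ^ 4) (2 * 4) ≤ κ / 2) (hδ₀ : 0 < δ₀) (hB₃ : 0 ≤ B₃) (hB : 0 ≤ B) (hκE : κ ≤ κE)
    (hr₀ : 0 < r₀) (hs0 : 0 < s) (hs1 : s < 1)
    (Ec : ℕ → ℕ → Type*) [∀ K k, NormedAddCommGroup (Ec K k)] [∀ K k, NormedSpace ℂ (Ec K k)]
    (ι : letI := θ.instVβ₁; letI := θ.instVβ₂
      (K k : ℕ) → (domSys (F.P K) M (k + 1)).Dom → ((Fin (F.P K).d → Site (F.P K) (k + 1) → θ.Vβ) →L[ℝ] Ec K k))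
    {Dt : Set ℂ} (hDt : IsOpen Dt) (hdisc : ∀ t ∈ Ioc (0 : ℝ) θ.γ, closedBall (t : ℂ) r₀ ⊆ Dt)
    (𝒢 : (K k : ℕ) → (ℕ → ℝ) → ℕ → (domSys (F.P K) M (k + 1)).Dom → ℂ × Ec K k → ℂ)
    (h𝒢 : ∀ (K k : ℕ), ∀ h ∈ Window θ.γ, ∀ (m : ℕ) (X : (domSys (F.P K) M (k + 1)).Dom), DifferentiableOn ℂ (𝒢 K k h m X) (Dt ×ˢ ball (0 : Ec K k) R))
    (hM𝒢 : ∀ (K k : ℕ), ∀ h ∈ Window θ.γ, ∀ (m : ℕ) (X : (domSys (F.P K) M (k + 1)).Dom), ∀ p ∈ Dt ×ˢ ball (0 : Ec K k) R,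
      ‖𝒢 K k h m X p‖ ≤ B * Real.exp (-(κE * (domSys (F.P K) M (k + 1)).dj X)))
    (hf : letI := θ.instVβ₁; letI := θ.instVβ₂
      ∀ (K k : ℕ), ∀ h ∈ Window θ.γ, ∀ (m : ℕ) (X : (domSys (F.P K) M (k + 1)).Dom), ∀ t ∈ Ioc (0 : ℝ) θ.γ,
        ∀ Bf : Fin (F.P K).d → Site (F.P K) (k + 1) → θ.Vβ,
          𝒢 K k h m X (t, ι K k X Bf) = ((S K) k).E (histPrefix (Function.update h m t) k) (emb K k (fun l u => NormedSpace.exp (θ.ρ8 (Bf l u)))) X)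
    (hIm : letI := θ.instVβ₁; letI := θ.instVβ₂
      ∀ (K k : ℕ), ∀ h ∈ Window θ.γ, ∀ (m : ℕ) (X : (domSys (F.P K) M (k + 1)).Dom), ∀ t ∈ Ioc (0 : ℝ) θ.γ,
        ∀ Bf : Fin (F.P K).d → Site (F.P K) (k + 1) → θ.Vβ,
          (((S K) k).E (histPrefix (Function.update h m t) k) (emb K k (fun l u => NormedSpace.exp (θ.ρ8 (Bf l u)))) X).im = 0)
    (w : (K k : ℕ) → (domSys (F.P K) M (k + 1)).Dom → Site (F.P K) (k + 1) → ℝ) (hw₀ : ∀ K k X t, 0 ≤ w K k X t)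
    (hw : letI := θ.instVβ₁; letI := θ.instVβ₂; letI := θ.instιβ
      ∀ (K k : ℕ) (X : (domSys (F.P K) M (k + 1)).Dom) (l : Fin (F.P K).d) (t : Site (F.P K) (k + 1)) (c : θ.ιβ),
        ‖ι K k X (Pi.single l (Pi.single t (θ.bV c)))‖ ≤ w K k X t)
    (htail : ∀ (K k : ℕ) (X : (domSys (F.P K) M (k + 1)).Dom) (t : Site (F.P K) (k + 1)),
      let e : Site (F.P K) (k + 1) → TPt 4 (domCount (F.P K) M (k + 1) * M) := fun x i => (ZMod.cast (x i) : ZMod (domCount (F.P K) M (k + 1) * M))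
      w K k X t ≤ B₃ * Real.exp (-δ₀ * distCT (domCount (F.P K) M (k + 1)) M (e t) (nearT (M := M) (e t) X)))
    (hκ₅ : delta1 δ₀ κ ((M : ℝ) * 4) ≤ κ₅) (hκd : delta1 δ₀ κ ((M : ℝ) * 4) ≤ κd)
    (hτω : ℓ.θ₅ ^ (1 - s) ≤ ℓ.ω) (hℓκ : ℓ.κ ≤ delta1 δ₀ κ ((M : ℝ) * 4))
    (hC₉ : 32 / (s ^ 2 * min (r₀ / 2) (θ.γ / 2)) * ((2 * (2 * C₅ / (1 - ℓ.θ₅) + 2 * E₀)) ^ (1 - s) *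
        (2 * ((16 * B * B₃ ^ 2 / R ^ 2) * Real.exp (delta1 δ₀ κ ((M : ℝ) * 4) * ((M : ℝ) * 4) * 3) * K₀ (4 * 2 ^ 4) (2 * 4) * K₁ 4 (δ₀ / 2) +
          (2 * C₅ / (1 - ℓ.θ₅) + 2 * E₀))) ^ s) / ℓ.θ₅ ^ (1 - s) ≤ ℓ.C₉)
    (k : ℕ) :
    N22At (rateCarriersOfRecord₁₃CoPH 𝔯 F θ hP g₀ os k).u3 :=
  n22At_rateCarriers_of_kernels_pin_of_ne9 𝔯 θ hP g₀ os ℓ hs hpin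
    (ne9_EA_objectsOfRecord₁₃_of_kernelStepRate_jointCharts F N θ.toStage13Params ℓ hs hγ hlim hC₅ hE₀ h5 hdec m' M hM S emb hloc hR hκ₀ hδ₀ hB₃ hB hκE
      hr₀ hs0 hs1 Ec ι hDt hdisc 𝒢 h𝒢 hM𝒢 hf hIm w hw₀ hw htail hκ₅ hκd hτω hℓκ hC₉) k

end Record

end YMDAG.N22.JointHoloLocalTerms

end
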